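import Literature.Computability.AlgebraicComplexity.TwoRowRectangleKronecker
import Literature.Computability.AlgebraicComplexity.DIP20PlethysmValuesRow3
import HarnessLib

/-!
# Sylvester's formula, plethysm side: `mult(S_{(δn-b,b)} U, S^δ(S^n U)) = P(b; δ × n) - P(b-1; δ × n)`
# (Bürgisser–Landsberg–Manivel–Weyman 2011, §8.3, (8.3.1)), PROVED

Topic `Literature/Computability/AlgebraicComplexity`; sibling proofs file (D-0014) of
`BLMW11KroneckerApproximation.lean` (named fact `BLMW2011_sylvester`, definitions `numPartitionsInBox` =
BLMW's `P(b; r × c)`). No new facts, no new definitions.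

P. Bürgisser, J. M. Landsberg, L. Manivel, J. Weyman, SIAM J. Comput. 40 (2011) = arXiv:0907.2850v2,
§8.3, eq. (8.3.1): "for a partition `π = (a, b)` of `δn` in two parts, `k_{π,δⁿ,δⁿ}` is equal to the
multiplicity of `S_πU` in `S^δ(S^nU)`. This is given by Sylvester's formula
`k_{(δn-b,b),δⁿ,δⁿ} = P(b; δ×n) - P(b-1; δ×n)`, where `P(b; δ×n)` denotes the number of partitions of
size `b` inside the rectangle `δ × n`."

**What is proved here** is the second printed sentence read on the PLETHYSM side — the classical
Cayley–Sylvester count of `SL_2`-covariants: for `dim U = 2`, `n ≥ 1`, `2b ≤ δn`,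

  `mult(S_{(δn-b,b)}U, S^δ(S^nU)) + P(b-1; δ×n) = P(b; δ×n)`   (`1 ≤ b`),   `= 1`   (`b = 0`)

(`plethysmCoeff_twoRow_add_numPartitionsInBox`, `plethysmCoeff_oneRow_eq_one`; the multiplicity is the
tree's `plethysmCoeff ℂ (Fin 2) n (rowDual ![δn-b, b])`, inner degree `n`, outer degree `δ`). The route
is the tree's, not the printed one (BLMW cite [Manivel]): the counting formula
`a_λ(d[n]) = Σ_{π ∈ S_ℓ} sgn(π) c_{λ+π-id}(d,n)` (Dörfler–Ikenmeyer–Panova 2020 (4.4), tree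
`DIP20_eq_4_4_holds`, in the `S_3`-expanded form `plethysmCoeff_fin_three_cast_eq_six_counts`) for the
three-row vector `(δn-b, b, 0)` — only the identity and the transposition of the first two rows survive —
the monomial counts `c_{(L,j,0)}(δ,n) = P(j; δ×n)` (DIP Prop. 4.5 (i), tree `dipMonomialCount_row_two_zero`),
and the independence of plethysm coefficients of the number of letters `≥ ℓ(λ)`
(`plethysmCoeffOfPartition_eq_of_card_parts_le`, two letters versus three).

Together with the tree's computation of the KRONECKER side (val-lit t05, `TwoRowRectangleKronecker.lean`,
`kroneckerCoeff_rectangle_rectangle_twoRow`, discharging `BLMW2011_sylvester`), the first printed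
sentence — the `GL_2` dictionary `k_{π,δⁿ,δⁿ} = mult(S_πU, S^δ(S^nU))` — becomes a THEOREM
(`kroneckerCoeff_rectangle_twoRow_eq_plethysmCoeff`). HONEST FRAMING: classical invariant theory of binary forms; nothing here bears on permanent
versus determinant; VP ≠ VNP is not proved.

## References

* [BurgisserEtAl2011] P. Bürgisser, J. M. Landsberg, L. Manivel, J. Weyman, SIAM J. Comput. 40 (2011),
  §8.3 eq. (8.3.1) (Sylvester's formula; `P(b; δ × n)`).
* [DorflerIkenmeyerPanova2020] eq. (4.3)–(4.4) and Prop. 4.5 (i) (arXiv p. 9).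

## Tree

`BLMW2011_sylvester`, `numPartitionsInBox` (`BLMW11KroneckerApproximation`); `kroneckerCoeff_rectangle_rectangle_twoRow`,
`numPartitionsInBox_eq_boxPartitionCount`, `boxPartitionCount_zero` (`TwoRowRectangleKronecker`), `boxPartitionCount_symm` (`DIP20MonomialCounts`); `DIP20_eq_4_4_holds`
(`DIP20PlethysmCountingFormulaProofs`), `plethysmCoeff_fin_three_cast_eq_six_counts` (`DIP20PlethysmValuesRow3`),
`dipMonomialCount_eq_L`, `dipMonomialCount_row_two_zero`, `boxPartitionCount` (`DIP20MonomialCounts`,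
`DIP20MultiplicityObstructions`), `plethysmCoeffOfPartition_eq_of_card_parts_le` (`OrbitClosureInheritance`),
`partitionOfRows` (`OccurrenceObstructionsBIP`), `rowDual_sortedParts`.
-/

open scoped BigOperators

namespace Literature.Computability.AlgebraicComplexity

open _root_.Literature.NumberTheory.DiophantineGeometry
open _root_.Literature.Computability.Complexity (partitionOfRows getD_sortedParts_partitionOfRows
  card_parts_partitionOfRows_le)

/-! ### Bookkeeping: BLMW's `P(b; r × c)` is DIP's `p_b(r,c)`; the list counter on a row `(L, j, 0)` -/

/-- The list counter of `DIP20MonomialCounts.lean` on a literal row `(L, j, 0)` is the monomial count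
`c_{(L,j,0)}(d,n) = p_j(d,n)`. [cite: DorflerIkenmeyerPanova2020, Prop. 4.5 (i) (arXiv p. 9)] -/
theorem countVecMultisetsL_row_two_zero {n d L j : ℕ} (hL : L + j = d * n) :
    countVecMultisetsL (weakCompsL 3 n) d [L, j, 0] = boxPartitionCount j d n := by
  rw [← dipMonomialCount_row_two_zero hL, dipMonomialCount_eq_L]
  rfl

/-! ### Three letters: `a_{(L,b,0)}(d[n]) + p_{b-1}(d,n) = p_b(d,n)` -/

/-- **Cayley–Sylvester on three letters**: for `L + b = d·n`, `b ≤ L`, `n ≥ 1`,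
`a_{(L,b,0)}(d[n]) + [1 ≤ b] p_{b-1}(d,n) = p_b(d,n)` — the counting formula (4.4) for `(L, b, 0)`, in
which only `π = id` and the transposition of the first two rows survive, and `c_{(L,j,0)}(d,n) = p_j(d,n)`.
[cite: BurgisserEtAl2011, §8.3 (8.3.1) (Sylvester's formula)] -/
theorem plethysmCoeff_rowDual_three_add (n d L b : ℕ) (hn : 0 < n) (hbL : b ≤ L) (hL : L + b = d * n) :
    plethysmCoeff ℂ (Fin 3) n (rowDual ![L, b, 0]) + (if 1 ≤ b then boxPartitionCount (b - 1) d n else 0) =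
      boxPartitionCount b d n := by
  have h := plethysmCoeff_fin_three_cast_eq_six_counts L b 0 (n := n) (d := d) hn hbL (Nat.zero_le b)
    (by rw [Nat.add_zero, hL])
  have h1 : ¬ (1 ≤ 0) := by omega
  have h2 : ¬ (2 ≤ 0) := by omega
  simp only [h1, h2, and_false, if_false, sub_zero, add_zero, countVecMultisetsL_row_two_zero hL] at h
  by_cases hb : 1 ≤ b
  · rw [if_pos hb] at h ⊢
    rw [countVecMultisetsL_row_two_zero (by omega : L + 1 + (b - 1) = d * n)] at h
    have : (plethysmCoeff ℂ (Fin 3) n (rowDual ![L, b, 0]) : ℤ) + (boxPartitionCount (b - 1) d n : ℤ) =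
        boxPartitionCount b d n := by rw [h]; ring
    exact_mod_cast this
  · rw [if_neg hb] at h ⊢
    rw [sub_zero] at h
    exact_mod_cast h

/-! ### Two letters versus three -/

/-- The plethysm coefficient of a two-row type does not see a third letter:
`mult(S_{(L,b)}(k²), S^d(S^n k²)) = mult(S_{(L,b,0)}(k³), S^d(S^n k³))` (`b ≤ L`), the tree's
independence of `a_λ` of the number of variables `≥ ℓ(λ)`. [cite: BurgisserEtAl2011, §8.3 (8.3.1)] -/
theorem plethysmCoeff_rowDual_two_eq_three (n L b : ℕ) (hbL : b ≤ L) :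
    plethysmCoeff ℂ (Fin 2) n (rowDual ![L, b]) = plethysmCoeff ℂ (Fin 3) n (rowDual ![L, b, 0]) := by
  classical
  haveI : Infinite ℂ := CharZero.infinite ℂ
  -- the partition with rows `(L, b)`
  set w : ℕ → ℕ := fun i => if i = 0 then L else if i = 1 then b else 0 with hw
  have hwanti : Antitone w := by
    intro i j hij
    simp only [hw]
    rcases Nat.lt_or_ge j 2 with hj | hj
    · interval_cases j <;> interval_cases i <;> simp [hbL]
    · have hj0 : j ≠ 0 := by omega
      have hj1 : j ≠ 1 := by omega
      simp [hj0, hj1]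
  have hwsum : ∑ r ∈ Finset.range 2, w r = L + b := by
    simp [Finset.sum_range_succ, hw]
  have hget := getD_sortedParts_partitionOfRows hwanti hwsum
  have hcard : (partitionOfRows w 2 (L + b)).parts.card ≤ 2 := card_parts_partitionOfRows_le hwanti hwsum
  have h2 : rowDual ![L, b] = Weight.dualOfPartition 2 (partitionOfRows w 2 (L + b)) := by
    rw [← rowDual_sortedParts]
    congr 1
    funext i
    rw [hget]
    fin_cases i <;> simp [hw]
  have h3 : rowDual ![L, b, 0] = Weight.dualOfPartition 3 (partitionOfRows w 2 (L + b)) := by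
    rw [← rowDual_sortedParts]
    congr 1
    funext i
    rw [hget]
    fin_cases i <;> simp [hw]
  rw [h2, h3]
  change plethysmCoeffOfPartition ℂ 2 n (partitionOfRows w 2 (L + b)) =
    plethysmCoeffOfPartition ℂ 3 n (partitionOfRows w 2 (L + b))
  exact (plethysmCoeffOfPartition_eq_of_card_parts_le (by norm_num : 2 ≤ 3) n _ hcard).symm

/-! ### Sylvester's formula, plethysm side -/

/-- **Sylvester's formula (BLMW 2011, (8.3.1)), plethysm side, `1 ≤ b`**: for `dim U = 2`, `n ≥ 1` and
`2b ≤ δn`, `mult(S_{(δn-b,b)}U, S^δ(S^nU)) + P(b-1; δ×n) = P(b; δ×n)` (the Cayley–Sylvester count of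
covariants of binary forms; additive form as in the typed fact `BLMW2011_sylvester`).
[cite: BurgisserEtAl2011, §8.3 (8.3.1) (Sylvester's formula)] -/
theorem plethysmCoeff_twoRow_add_numPartitionsInBox (n δ b : ℕ) (hn : 0 < n) (hb : 2 * b ≤ n * δ)
    (hb1 : 1 ≤ b) :
    plethysmCoeff ℂ (Fin 2) n (rowDual ![n * δ - b, b]) + numPartitionsInBox (b - 1) δ n =
      numPartitionsInBox b δ n := by
  rw [plethysmCoeff_rowDual_two_eq_three n _ _ (by omega), numPartitionsInBox_eq_boxPartitionCount,
    numPartitionsInBox_eq_boxPartitionCount]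
  have h := plethysmCoeff_rowDual_three_add n δ (n * δ - b) b hn (by omega)
    (by rw [Nat.mul_comm δ n]; omega)
  rwa [if_pos hb1] at h

/-- **Sylvester's formula, plethysm side, `b = 0`**: `mult(S_{(δn)}U, S^δ(S^nU)) = 1 = P(0; δ×n)` for
`n ≥ 1` (the one copy of `S^{δn}U ⊂ S^δ(S^nU)`). [cite: BurgisserEtAl2011, §8.3 (8.3.1) (Sylvester's formula)] -/
theorem plethysmCoeff_oneRow_eq_numPartitionsInBox (n δ : ℕ) (hn : 0 < n) :
    plethysmCoeff ℂ (Fin 2) n (rowDual ![n * δ - 0, 0]) = numPartitionsInBox 0 δ n := by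
  rw [plethysmCoeff_rowDual_two_eq_three n _ _ (Nat.zero_le _), numPartitionsInBox_eq_boxPartitionCount]
  have h := plethysmCoeff_rowDual_three_add n δ (n * δ - 0) 0 hn (Nat.zero_le _)
    (by rw [Nat.mul_comm δ n]; omega)
  simpa using h

/-- **Sylvester's formula, plethysm side, `b = 0`, as printed**: `mult(S_{(δn)}U, S^δ(S^nU)) = 1`
(`n ≥ 1`). [cite: BurgisserEtAl2011, §8.3 (8.3.1) (Sylvester's formula)] -/
theorem plethysmCoeff_oneRow_eq_one (n δ : ℕ) (hn : 0 < n) :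
    plethysmCoeff ℂ (Fin 2) n (rowDual ![n * δ - 0, 0]) = 1 := by
  rw [plethysmCoeff_oneRow_eq_numPartitionsInBox n δ hn, numPartitionsInBox_eq_boxPartitionCount,
    boxPartitionCount_zero]

/-- **BLMW 2011 (8.3.1), first sentence, as a THEOREM**: "for a partition `π = (a, b)` of `δn` in
two parts, `k_{π,δⁿ,δⁿ}` is equal to the multiplicity of `S_πU` in `S^δ(S^nU)`" (`dim U = 2`, `n ≥ 1`) —
both sides equal `P(b; δ×n) - P(b-1; δ×n)`: the Kronecker side by the tree's Pak–Panova computation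
`kroneckerCoeff_rectangle_rectangle_twoRow` (val-lit t05, with `P(b; n×δ) = P(b; δ×n)`,
`boxPartitionCount_symm`), the plethysm side by the Cayley–Sylvester count above.
[cite: BurgisserEtAl2011, §8.3 (8.3.1)] -/
theorem kroneckerCoeff_rectangle_twoRow_eq_plethysmCoeff (n δ b : ℕ) (hn : 0 < n) (hb : 2 * b ≤ n * δ) :
    kroneckerCoeff ℂ (Nat.Partition.rectangle n δ) (Nat.Partition.rectangle n δ)
        (Nat.Partition.twoRow (n * δ) b (by omega)) =
      plethysmCoeff ℂ (Fin 2) n (rowDual ![n * δ - b, b]) := by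
  have hk := kroneckerCoeff_rectangle_rectangle_twoRow n δ b hb
  rw [boxPartitionCount_symm b, boxPartitionCount_symm (b - 1)] at hk
  rcases Nat.eq_zero_or_pos b with rfl | hb1
  · rw [if_pos rfl, sub_zero, boxPartitionCount_zero] at hk
    rw [plethysmCoeff_oneRow_eq_one n δ hn]
    exact_mod_cast hk
  · rw [if_neg (by omega)] at hk
    have hp := plethysmCoeff_twoRow_add_numPartitionsInBox n δ b hn hb hb1
    rw [numPartitionsInBox_eq_boxPartitionCount, numPartitionsInBox_eq_boxPartitionCount] at hp
    have : (kroneckerCoeff ℂ (Nat.Partition.rectangle n δ) (Nat.Partition.rectangle n δ)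
        (Nat.Partition.twoRow (n * δ) b (by omega)) : ℤ) =
        plethysmCoeff ℂ (Fin 2) n (rowDual ![n * δ - b, b]) := by
      rw [hk]
      have := congrArg (fun x : ℕ => (x : ℤ)) hp
      push_cast at this
      linarith
    exact_mod_cast this

/-! ### Hermite reciprocity for two-row types -/

/-- **Hermite's reciprocity (1854) for two-row types, as a corollary of the Cayley–Sylvester count**:
`mult(S_{(nd-b,b)}U, S^d(S^nU)) = mult(S_{(nd-b,b)}U, S^n(S^dU))` for `dim U = 2`, `n, d ≥ 1`,
`2b ≤ nd` — both sides are `P(b; d×n) - P(b-1; d×n)` and the box count is symmetric under transposing the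
box (`boxPartitionCount_symm`). Dörfler–Ikenmeyer–Panova 2020 cite it as the 2-row equality case of
Foulkes' conjecture (arXiv p. 3, "[Her1854]"). [cite: DorflerIkenmeyerPanova2020, §2 (arXiv p. 3, Hermite reciprocity [Her1854])] -/
theorem plethysmCoeff_twoRow_hermite_reciprocity (n d b : ℕ) (hn : 0 < n) (hd : 0 < d)
    (hb : 2 * b ≤ n * d) :
    plethysmCoeff ℂ (Fin 2) n (rowDual ![n * d - b, b]) = plethysmCoeff ℂ (Fin 2) d (rowDual ![d * n - b, b]) := by
  rcases Nat.eq_zero_or_pos b with rfl | hb1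
  · rw [plethysmCoeff_oneRow_eq_one n d hn, plethysmCoeff_oneRow_eq_one d n hd]
  · have h1 := plethysmCoeff_twoRow_add_numPartitionsInBox n d b hn hb hb1
    have h2 := plethysmCoeff_twoRow_add_numPartitionsInBox d n b hd (by rw [Nat.mul_comm d n]; exact hb) hb1
    rw [numPartitionsInBox_eq_boxPartitionCount, numPartitionsInBox_eq_boxPartitionCount,
      boxPartitionCount_symm b, boxPartitionCount_symm (b - 1)] at h2
    rw [numPartitionsInBox_eq_boxPartitionCount, numPartitionsInBox_eq_boxPartitionCount] at h1
    omega

end Literature.Computability.AlgebraicComplexity
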